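import Summits.QuantumFields.BalabanUV.Gaps.CapSignsNecessaryFwd

/-!
# Gaps / CapSignsRefutationSocket — the REFUTATION SOCKETS of row CAP-k: what a certified NEGATIVE finding at ONE scale refutes [I] Theorem 2 AS
# TYPED for every forward-generated construction — split-free (the full β_{k+1} nonpositive on one small box), split form (β⁰_{k+1} < 0 + one-sided
# near-zero control of β¹ at that scale), certificate forms; all with FORWARD GENERATION ONLY (cell pub-balaban-gaps, seat g1-p3 gen 3, CAP+tail
# charge; §§1–2 ADOPT g1-plan-2 GEN 10's X-54 kernel `g1/skeletons/XreadNegSocketWeakest_plan2.lean` 245830e9499c3828, re-based on `hgen` only)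

HONEST FRAMING (cell rule, page 1 of everything): bookkeeping; NOTHING of Bałaban's is asserted beyond print; [Balaban1987RG1] Thm 2 is UNPROVED IN
PRINT; NO coefficient of Bałaban's β⁰ and NO enclosure of his β_{k+1} is certified to date (b2b BETA/CERT.md: «0 coefficients»); this file only NAMES
the exits a certified negative finding would take; 0 binders discharged; NOT `BetaPertH`, NOT the continuum limit, NOT Clay.  HONEST DEPENDENCY
(b2b cell, verbatim): «continuum YM on T⁴ ⇐ BetaPertH ∧ nine spine estimates (0/9 proved); BetaPertH ⇐ (D1) ∧ (D4) ∧ CAP+tail; G-an2-4 gates asym,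
D1 and NE2/3/4.»

CONTENT.  The positive socket of row CAP-k is gen 0's `CapTailSigns.thm2Printed_of_posRows` (certified `0 < lo k ≤ β⁰_{k+1}` below `k₀` + the tail
⟹ (0.31)).  Here the NEGATIVE sockets, all for EVERY forward-generated construction (`hgen` only, via `CapSignsNecessaryFwd`) and every `L > 1`:
§1 SPLIT-FREE (X-54a): `not_thm2Printed_of_boxNonpos` — at ONE scale `k` the full `β_{k+1}` is `≤ 0` on SOME small box `]0,γ]^{k+1}` ⟹ ¬(0.31);
   `_boxLe`; certificate form `not_thm2Printed_of_certifiedBox` (rational `γ > 0`, `hi ≤ 0`, `β_{k+1} ≤ hi` on the box) — what a numerics desk must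
   ENCLOSE to take the exit is `β_{k+1}` on a box, not `β⁰_{k+1}` alone.
§2 SPLIT FORM (X-54b): `not_thm2Printed_of_beta0_neg_oneScale` — `β⁰_{k+1} < 0` + the ONE-SIDED near-zero control `β¹_{k+1} ≤ ε` at THAT scale;
   `_oneBox`; (the two-sided all-scales form is `CapSignsNecessaryFwd.not_thm2Printed_of_beta0_neg_fwd`) `_closedBox` ∕ `_everySlope` ∕ `_limitForm`;
   certificate form `not_thm2Printed_of_certifiedNeg` (rational `hi < 0` with `β⁰_{k+1} ≤ hi`).
§3 `twoSidedTest_limitForm` — on the limit-form road: certified strict signs below `k₀` ⟹ (0.31); one certified negative coefficient ⟹ ¬(0.31)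
   (a certified ZERO is the remainder's case, `CapFloorNotNecessary.boundary_decided_by_remainder`); `_datum` on `T4Continuum.FiniteEpsData`.
§4 SCHEME FORM: `beta0_nonneg_of_thm2Printed_scheme` ∕ `_epsFamily` — across a family of constructions indexed by `ε₁` with COMMON one-loop
   coefficients and a remainder shrinking with the member (`RemainderResidueFamily.EpsFamily`), Theorem 2 as typed for EVERY member ⟹ `0 ≤ β⁰_{k+1}`
   — the near-zero control is REPLACED by «ε₁ sufficiently small» (the face witness is defeated by the family); `exists_member_not_thm2Printed_of_beta0_neg`.
READING CAVEATS (kernel-located): the near-zero control in §2 is load-bearing for ONE construction (`CapFloorNotNecessary.nearZero_control_needed`);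
every exit rides on the coarse lattice `K = k+1` of the typed ∀-K statement (`CapSignsNecessaryFineWitness.earlySign_necessity_is_coarse`).
All [folklore]; 0 sorry; 0 def.
-/

namespace Summit.QuantumFields.BalabanUV.Gaps.CapSignsRefutationSocket

open Literature.MathematicalPhysics.QuantumFieldTheory.Balaban1983to89
open Literature.MathematicalPhysics.QuantumFieldTheory.Balaban1983to89.FlowStep
open Literature.MathematicalPhysics.QuantumFieldTheory.Balaban1983to89.FlowStepRuns
open Literature.MathematicalPhysics.QuantumFieldTheory.Balaban1983to89.DagBinding
open Summit.QuantumFields.BalabanUV.Gaps.CapSignsConstRoad (EverySlope everySlope_of_af1)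
open Summit.QuantumFields.BalabanUV.Gaps.CapSignsNecessary (remainderSmallAtZero_of_continuousOn_closedBox)
open Summit.QuantumFields.BalabanUV.Gaps.CapSignsNecessaryFwd

noncomputable section

variable {β : HBeta}

/-! ## §1 Split-free: the full β-function nonpositive on one small box at one scale (g1-plan-2 X-54a) -/

/-- **SPLIT-FREE NEGATIVE SOCKET.**  For a forward-generated construction and `L > 1`: if at ONE scale `k` the β-function `β_{k+1}` is NONPOSITIVE
on SOME small box `]0,γ]^{k+1}` (`γ > 0`), then [I] Theorem 2 as typed fails — no split, no remainder, no near-zero control (contrapositive of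
`CapSignsNecessaryFwd.exists_boxPoint_ge_of_thm2Printed_fwd`; adopted from g1-plan-2's X-54a). [cite: Balaban1987RG1, Thm 2 (0.31) p.259] -/
theorem not_thm2Printed_of_boxNonpos {C : B12.Construction} (hgen : ForwardGenerated C β) {L : ℝ} (hL : 1 < L) {k : ℕ} {γ : ℝ}
    (hγ : 0 < γ) (hnonpos : ∀ v ∈ Box γ k, β k v ≤ 0) : ¬ B12.Thm2Printed C L := by
  intro h
  obtain ⟨γ₂, hγ₂, hγ₂'⟩ := exists_boxPoint_ge_of_thm2Printed_fwd hgen h 0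
  obtain ⟨b, hb, hk⟩ := hγ₂' (min γ₂ γ) (lt_min hγ₂ hγ) (min_le_left _ _)
  obtain ⟨v, hv, hbv⟩ := hk k
  have hvγ : v ∈ Box γ k := mem_box.mpr fun i => ⟨(mem_box.mp hv i).1, (mem_box.mp hv i).2.trans (min_le_right _ _)⟩
  have hpos : 0 < b * Real.log L := mul_pos hb (Real.log_pos hL)
  have := hnonpos v hvγ
  linarith

/-- The same with an upper value `c ≤ 0` on the box (e.g. a certified enclosure top). [cite: Balaban1987RG1, Thm 2 (0.31) p.259] -/
theorem not_thm2Printed_of_boxLe {C : B12.Construction} (hgen : ForwardGenerated C β) {L : ℝ} (hL : 1 < L) {k : ℕ} {γ c : ℝ}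
    (hγ : 0 < γ) (hc : c ≤ 0) (hle : ∀ v ∈ Box γ k, β k v ≤ c) : ¬ B12.Thm2Printed C L :=
  not_thm2Printed_of_boxNonpos hgen hL hγ fun v hv => (hle v hv).trans hc

/-- **CERTIFICATE FORM, split-free**: a rational box size `γ > 0`, a rational `hi ≤ 0` and ONE scale `k` with `β_{k+1}(v) ≤ hi` for all
`v ∈ ]0,γ]^{k+1}` refute Theorem 2 as typed for every forward-generated construction, every `L > 1`.  What must be ENCLOSED is the FULL β-function on
a box; NO such enclosure exists to date. [cite: Balaban1987RG1, Thm 2 (0.31) p.259] -/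
theorem not_thm2Printed_of_certifiedBox {C : B12.Construction} (hgen : ForwardGenerated C β) {L : ℝ} (hL : 1 < L) {k : ℕ}
    (γ hi : ℚ) (hγ : 0 < γ) (hhi : hi ≤ 0) (hle : ∀ v ∈ Box ((γ : ℚ) : ℝ) k, β k v ≤ ((hi : ℚ) : ℝ)) : ¬ B12.Thm2Printed C L :=
  not_thm2Printed_of_boxLe hgen hL (by exact_mod_cast hγ) (by exact_mod_cast hhi) hle

/-! ## §2 Split form: a negative one-loop coefficient plus near-zero control at that scale (g1-plan-2 X-54b; (N1)'s contrapositive) -/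

/-- **THE SPLIT FORM WITH THE WEAKEST CONTROL**: `β⁰_{k+1} < 0` at ONE scale `k` + the ONE-SIDED near-zero control of `β¹_{k+1}` AT THAT SCALE
(`∀ ε > 0 ∃ γ > 0, β¹_{k+1} ≤ ε on ]0,γ]^{k+1}`) ⟹ `¬ B12.Thm2Printed C L` (forward generation only). [cite: Balaban1987RG1, Thm 2 (0.31) p.259] -/
theorem not_thm2Printed_of_beta0_neg_oneScale {C : B12.Construction} (hgen : ForwardGenerated C β) (S : B12Beta.OneLoopSplit β) {k : ℕ}
    (hneg : S.β0 k < 0) (hRk : ∀ ε : ℝ, 0 < ε → ∃ γ : ℝ, 0 < γ ∧ ∀ p ∈ B12Beta.HistBox γ k, S.β1 k p ≤ ε)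
    {L : ℝ} (hL : 1 < L) : ¬ B12.Thm2Printed C L := by
  obtain ⟨γ, hγ, hγ'⟩ := hRk (-(S.β0 k)) (by linarith)
  refine not_thm2Printed_of_boxNonpos (k := k) hgen hL hγ fun v hv => ?_
  have h1 := hγ' v (fun i => mem_box.mp hv i)
  rw [S.split k v]
  linarith

/-- Even less: `β¹_{k+1} ≤ −β⁰_{k+1}` on ONE small box. [cite: Balaban1987RG1, Thm 2 (0.31) p.259] -/
theorem not_thm2Printed_of_beta0_neg_oneBox {C : B12.Construction} (hgen : ForwardGenerated C β) (S : B12Beta.OneLoopSplit β) {k : ℕ}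
    {γ : ℝ} (hγ : 0 < γ) (hbox : ∀ p ∈ B12Beta.HistBox γ k, S.β1 k p ≤ -(S.β0 k)) {L : ℝ} (hL : 1 < L) :
    ¬ B12.Thm2Printed C L := by
  refine not_thm2Printed_of_boxNonpos (k := k) hgen hL hγ fun v hv => ?_
  have h1 := hbox v (fun i => mem_box.mp hv i)
  rw [S.split k v]
  linarith

/-- With the print-shaped supplier: continuity of `β¹_{k+1}` on the closed boxes `[0,γ]^{k+1}` ([I] p. 264 reading) + printed vanishing.
[cite: Balaban1987RG1, Thm 2 (0.31) p.259 and §1 p.264] -/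
theorem not_thm2Printed_of_beta0_neg_closedBox {C : B12.Construction} (hgen : ForwardGenerated C β) (S : B12Beta.OneLoopSplit β)
    {γ : ℝ} (hγ : 0 < γ) (hcont : ∀ k, ContinuousOn (S.β1 k) (Set.pi Set.univ fun _ : Fin (k + 1) => Set.Icc 0 γ))
    {k : ℕ} (hneg : S.β0 k < 0) {L : ℝ} (hL : 1 < L) : ¬ B12.Thm2Printed C L :=
  not_thm2Printed_of_beta0_neg_fwd hgen S (remainderSmallAtZero_of_continuousOn_closedBox S hγ hcont) hneg hL

/-- On the every-slope ∕ (D4) road. [cite: Balaban1987RG1, Thm 2 (0.31) p.259] -/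
theorem not_thm2Printed_of_beta0_neg_everySlope {C : B12.Construction} (hgen : ForwardGenerated C β) (S : B12Beta.OneLoopSplit β)
    {γc : ℝ} (hrem : EverySlope S γc) {k : ℕ} (hneg : S.β0 k < 0) {L : ℝ} (hL : 1 < L) : ¬ B12.Thm2Printed C L :=
  fun h => absurd (beta0_nonneg_of_thm2Printed_fwd_everySlope hgen S hrem hL h k) (not_le.mpr hneg)

/-- On the limit-form road. [cite: Balaban1987RG1, Thm 2 (0.31) p.259] -/
theorem not_thm2Printed_of_beta0_neg_limitForm (D : Beta.Assembly.LimitForm β) {C : B12.Construction} (hgen : ForwardGenerated C β)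
    {k : ℕ} (hneg : D.S.β0 k < 0) {L : ℝ} (hL : 1 < L) : ¬ B12.Thm2Printed C L :=
  fun h => absurd (beta0_nonneg_of_thm2Printed_fwd_limitForm D hgen hL h k) (not_le.mpr hneg)

/-- **CERTIFICATE FORM, split** (cf. the positive socket `CapTailSigns.thm2Printed_of_posRows` with rational `lo k`): a rational `hi < 0` with
`β⁰_{k+1} ≤ hi` at ONE scale + the one-sided near-zero control at that scale ⟹ ¬ Theorem 2 as typed (every forward-generated `C`, every
`L > 1`).  NO such certificate exists to date. [cite: Balaban1987RG1, Thm 2 (0.31) p.259] -/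
theorem not_thm2Printed_of_certifiedNeg {C : B12.Construction} (hgen : ForwardGenerated C β) (S : B12Beta.OneLoopSplit β) {k : ℕ}
    (hi : ℚ) (hhi : hi < 0) (hle : S.β0 k ≤ ((hi : ℚ) : ℝ))
    (hRk : ∀ ε : ℝ, 0 < ε → ∃ γ : ℝ, 0 < γ ∧ ∀ p ∈ B12Beta.HistBox γ k, S.β1 k p ≤ ε) {L : ℝ} (hL : 1 < L) :
    ¬ B12.Thm2Printed C L :=
  not_thm2Printed_of_beta0_neg_oneScale hgen S (hle.trans_lt (by exact_mod_cast hhi)) hRk hL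

/-! ## §3 The two-sided test, assembled -/

/-- **THE TWO-SIDED TEST** (limit-form road, forward generation only, `L > 1`): certified STRICT signs decide — `0 < β⁰_{k+1}` for all `k < k₀`
⟹ (0.31) (`CapTailSigns.thm2Printed_of_signs`); ONE `β⁰_{k+1} < 0` ⟹ ¬(0.31).  A certified ZERO coefficient is the remainder's case
(`CapFloorNotNecessary.boundary_decided_by_remainder`). [cite: Balaban1987RG1, Thm 2 (0.31) p.259] -/
theorem twoSidedTest_limitForm (D : Beta.Assembly.LimitForm β) {C : B12.Construction} (hgen : ForwardGenerated C β) {L : ℝ} (hL : 1 < L) :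
    ((∀ k, k < D.k₀ → 0 < D.S.β0 k) → B12.Thm2Printed C L) ∧ (∀ k, D.S.β0 k < 0 → ¬ B12.Thm2Printed C L) :=
  ⟨fun hsign => CapTailSigns.thm2Printed_of_signs D hgen hL hsign, fun _ hneg => not_thm2Printed_of_beta0_neg_limitForm D hgen hneg hL⟩

/-- The two-sided test ON THE DATUM `D : T4Continuum.FiniteEpsData F G` (via `D.fwd`). [cite: Balaban1987RG1, Thm 2 (0.31) p.259] -/
theorem twoSidedTest_datum {F : T4Continuum.T4Family} {G : Type*} [GaugeGroup G] [MeasurableSpace G] [HaarData G]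
    (D : T4Continuum.FiniteEpsData F G) (Lf : Beta.Assembly.LimitForm D.βfun) {L : ℝ} (hL : 1 < L) :
    ((∀ k, k < Lf.k₀ → 0 < Lf.S.β0 k) → B12.Thm2Printed D.C.toB12 L) ∧ (∀ k, Lf.S.β0 k < 0 → ¬ B12.Thm2Printed D.C.toB12 L) :=
  twoSidedTest_limitForm Lf D.fwd hL

/-! ## §4 Scheme form: across Bałaban's family of constructions the near-zero control is replaced by «ε₁ sufficiently small» -/

/-- **(N1) IN THE SCHEME CURRENCY — no continuity at the face needed.**  For a family `e ↦ (βf e, Sf e, Cf e)` of splits and forward-generated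
constructions indexed by the activity parameter `e = ε₁` ([II] p. 21: a choice of `ε₁` is a choice of the construction), whose one-loop
coefficients are COMMON (`hβ0`, the displayed reading of `CapSignsConstRoad.exists_member_thm2Printed_of_signs`) and whose remainder can be made
`≤ s` on some box by choosing the member (`hfam`, e.g. from `RemainderResidueFamily.exists_remainderConst_of_epsFamily`): if Theorem 2 as typed
holds for EVERY member (`∀ e > 0, B12.Thm2Printed (Cf e) L` — the printed «ε₁ sufficiently small» read as «for all small ε₁»), then
`0 ≤ β⁰_{k+1}` for every `k`.  The fixed-constant FACE witness (`CapFloorNotNecessary.nearZero_control_needed`) is defeated by the family: its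
remainder constant does not shrink. [cite: Balaban1987RG1, Thm 2 (0.31) p.259 and Thm 3 p.264; Balaban1988RG2Cluster, p.21] -/
theorem beta0_nonneg_of_thm2Printed_scheme {βf : ℝ → HBeta} (Sf : (e : ℝ) → B12Beta.OneLoopSplit (βf e))
    (Cf : ℝ → B12.Construction) (hgen : ∀ e, 0 < e → ForwardGenerated (Cf e) (βf e)) {b0 : ℕ → ℝ}
    (hβ0 : ∀ e, 0 < e → (Sf e).β0 = b0)
    (hfam : ∀ s : ℝ, 0 < s → ∃ e : ℝ, 0 < e ∧ ∃ γ : ℝ, 0 < γ ∧ Beta.RemainderChain.RemainderConst (Sf e) γ s)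
    {L : ℝ} (hL : 1 < L) (hT : ∀ e, 0 < e → B12.Thm2Printed (Cf e) L) (k : ℕ) : 0 ≤ b0 k := by
  refine le_of_not_gt fun hneg => ?_
  obtain ⟨e, he, γ₀, hγ₀, hR⟩ := hfam (-(b0 k) / 2) (by linarith)
  obtain ⟨γ₂, hγ₂, hγ⟩ := exists_boxPoint_ge_of_thm2Printed_fwd (hgen e he) (hT e he) 0
  obtain ⟨b, hb, hk⟩ := hγ (min γ₂ γ₀) (lt_min hγ₂ hγ₀) (min_le_left _ _)
  obtain ⟨v, hv, hbv⟩ := hk k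
  have hvH : v ∈ B12Beta.HistBox γ₀ k := fun i => ⟨(mem_box.mp hv i).1, (mem_box.mp hv i).2.trans (min_le_right _ _)⟩
  have h1 := (abs_le.mp (hR k v hvH)).2
  have hpos : 0 < b * Real.log L := mul_pos hb (Real.log_pos hL)
  rw [(Sf e).split k v, hβ0 e he] at hbv
  linarith

/-- The scheme form over g1-p2's `RemainderResidueFamily.EpsFamily` (the (D4) family currency): Theorem 2 as typed for EVERY member
⟹ the common one-loop coefficients are all `≥ 0`. [cite: Balaban1987RG1, Thm 2 (0.31) p.259; Balaban1988RG2Cluster, p.21] -/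
theorem beta0_nonneg_of_thm2Printed_epsFamily {βf : ℝ → HBeta} {Sf : (e : ℝ) → B12Beta.OneLoopSplit (βf e)}
    (hE : Beta.RemainderResidueFamily.EpsFamily βf Sf) (Cf : ℝ → B12.Construction)
    (hgen : ∀ e, 0 < e → ForwardGenerated (Cf e) (βf e)) {b0 : ℕ → ℝ} (hβ0 : ∀ e, 0 < e → (Sf e).β0 = b0)
    {L : ℝ} (hL : 1 < L) (hT : ∀ e, 0 < e → B12.Thm2Printed (Cf e) L) : ∀ k, 0 ≤ b0 k :=
  beta0_nonneg_of_thm2Printed_scheme Sf Cf hgen hβ0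
    (fun s hs => by
      obtain ⟨e, he, γ₀, hγ₀, hR⟩ := Beta.RemainderResidueFamily.exists_remainderConst_of_epsFamily hE hs
      exact ⟨e, he, γ₀, hγ₀, hR⟩) hL hT

/-- The scheme-form NEGATIVE socket: a certified `β⁰_{k+1} < 0` of the COMMON one-loop coefficients refutes «Theorem 2 as typed for every member
of the scheme» — some admissible choice of `ε₁` violates (0.31). [cite: Balaban1987RG1, Thm 2 (0.31) p.259] -/
theorem exists_member_not_thm2Printed_of_beta0_neg {βf : ℝ → HBeta} (Sf : (e : ℝ) → B12Beta.OneLoopSplit (βf e))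
    (Cf : ℝ → B12.Construction) (hgen : ∀ e, 0 < e → ForwardGenerated (Cf e) (βf e)) {b0 : ℕ → ℝ}
    (hβ0 : ∀ e, 0 < e → (Sf e).β0 = b0)
    (hfam : ∀ s : ℝ, 0 < s → ∃ e : ℝ, 0 < e ∧ ∃ γ : ℝ, 0 < γ ∧ Beta.RemainderChain.RemainderConst (Sf e) γ s)
    {L : ℝ} (hL : 1 < L) {k : ℕ} (hneg : b0 k < 0) : ∃ e : ℝ, 0 < e ∧ ¬ B12.Thm2Printed (Cf e) L := by
  by_contra hall
  have hT : ∀ e, 0 < e → B12.Thm2Printed (Cf e) L := fun e he =>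
    Classical.by_contradiction fun hne => hall ⟨e, he, hne⟩
  exact absurd (beta0_nonneg_of_thm2Printed_scheme Sf Cf hgen hβ0 hfam hL hT k) (not_le.mpr hneg)

end

end Summit.QuantumFields.BalabanUV.Gaps.CapSignsRefutationSocket
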